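import Summits.ResolutionOfSingularities.ResolutionOfSingularities.Theorems.FrobeniusLadderFInjectiveMacaulayficationSliceGenusDiscOrder
import HarnessLib

/-!
# K-T1 WITHOUT THE NORMALISATION: the slice cubic `x³ + q₁(r)x² + q₂(r)x + q₃(r)` with `deg q₁ ≤ 2`, `q₁(0) = β ≠ 0` (not only `q₁ ≡ β`) — the Tschirnhaus step
# `X = 3x + (q₁ − β)` is done in the kernel, division-free: `Disc_x(27·Q((X − s)/3)) = 729·Disc_x Q`, and `27·Q((X − s)/3)` is in the normal form of ✓ `SliceGenusDiscOrder`
# (crux `FInjectiveMacaulayfication` stmt-ResolutionOfSingularities-15315, chain w45a; completes ✓p722715 (res-L1-w45a-plan-1 R25.13 (b) / R25.18) by the reduction «WLOG q₁ ≡ β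
# (x ↦ x − (q₁−β)/3 preserves deg q_j ≤ 2j, q₂(0) = 0, ord q₃ ≥ 2 and Disc; char ≠ 3)» of res-L1-w45a-tri-2 g23 `O2O3-BREAKTEST-tri2.md` 1a0171e63bbb2316 §2.4, which ✓p722715 left
# memo-level; seat res-L1-w45a-stub-1 g17)

[OURS · L1 W4.5a] Support file (`--supports stmt-ResolutionOfSingularities-15315 --as helper`); theorems only; UNCONDITIONAL; `ring` identities + ✓ `discr_eq_zero_of_coeff_eq_zero`; no named fact;
NOT a statement of any manuscript; nothing of the crux is proved (kernel form of the T1 arithmetic INCLUDING its normalisation step; the identification «slice of the drop-point equation at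
the literal flag = this weighted-degree-6 cubic» stays memo-level [ELEM two engines]). AI-written (AI review is weaker than expert review).

THE REDUCTION. For `Q = x³ + b x² + c x + d` over any commutative ring and any `s`, the cubic `Q̃ := 27·Q((X − s)/3) = X³ + 3(b − s)X² + (3s² − 6bs + 9c)X + (−s³ + 3bs² − 9cs + 27d)`
has `Disc_X Q̃ = 729·Disc_x Q` (§1 `discr_tschirnhaus_scaled`, `ring`: translation invariance and weight-6 homogeneity of the cubic discriminant at once, no division by 3). With
`b = q₁ = β + β₁r + β₂r²`, `s = β₁r + β₂r²`, `c = q₂ = Σ₁⁴ aᵢrⁱ`, `d = q₃ = Σ₂⁶ bᵢrⁱ` the new coefficients are `3β` (constant) and polynomials `q̃₂ = Σ₁⁴ ãᵢrⁱ`, `q̃₃ = Σ₂⁶ b̃ᵢrⁱ` of the SAME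
shape (`ã₁ = 9a₁ − 6ββ₁`, `ã₂ = 9a₂ − 6ββ₂ − 3β₁²`, `ã₃ = 9a₃ − 6β₁β₂`, `ã₄ = 9a₄ − 3β₂²`; `b̃₂ = 27b₂ − 9a₁β₁ + 3ββ₁²`, `b̃₃ = 27b₃ − 9(a₁β₂ + a₂β₁) + 6ββ₁β₂ + 2β₁³`,
`b̃₄ = 27b₄ − 9(a₂β₂ + a₃β₁) + 3ββ₂² + 6β₁²β₂`, `b̃₅ = 27b₅ − 9(a₃β₂ + a₄β₁) + 6β₁β₂²`, `b̃₆ = 27b₆ − 9a₄β₂ + 2β₂³` — §1 `discr_normalise`), so ✓ `discr_eq_zero_of_coeff_eq_zero` applies to `Q̃`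
(`3β ≠ 0`) and `729 = 3⁶` is a unit: §2 ★★★ `discr_eq_zero_of_coeff_eq_zero_general` — **for `Q = x³ + q₁x² + q₂x + q₃ ∈ K[r][x]` with `deg q₁ ≤ 2`, `q₁(0) = β ≠ 0`, `deg q₂ ≤ 4`, `q₂(0) = 0`,
`deg q₃ ≤ 6`, `ord q₃ ≥ 2`, `char K ∉ {2,3}`: if the coefficients of `r⁰ … r⁹` of `Disc_x Q` vanish then `Disc_x Q = 0`.**
[folklore computation]
-/

-- single-problem summit: the doubled namespace component is forced
set_option linter.dupNamespace false

namespace Summit.ResolutionOfSingularities.ResolutionOfSingularities.Theorems.FInjectiveMacaulayfication.SliceGenusDiscOrder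

section Ring

variable {A : Type*} [CommRing A]

/-- **TSCHIRNHAUS, DIVISION-FREE**: for `Q = x³ + bx² + cx + d` and any `s`, the monic cubic `27·Q((X − s)/3) = X³ + 3(b − s)X² + (3s² − 6bs + 9c)X + (−s³ + 3bs² − 9cs + 27d)` has
discriminant `729·Disc Q` (translation invariance ∧ weighted homogeneity of degree 6). [classical; `ring`] -/
theorem discr_tschirnhaus_scaled (b c d s : A) :
    Cubic.discr (⟨1, 3 * (b - s), 3 * s ^ 2 - 6 * b * s + 9 * c, -s ^ 3 + 3 * b * s ^ 2 - 9 * c * s + 27 * d⟩ : Cubic A) =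
      729 * Cubic.discr (⟨1, b, c, d⟩ : Cubic A) := by
  simp only [Cubic.discr]
  ring

open Polynomial in
/-- **THE NORMALISATION IN THE SLICE LETTERS**: with `q₁ = β + β₁r + β₂r²`, `q₂ = Σ₁⁴ aᵢrⁱ`, `q₃ = Σ₂⁶ bᵢrⁱ` and `s = β₁r + β₂r²`, the cubic `27·Q((X − s)/3)` is the NORMAL-FORM cubic
`X³ + (3β)X² + q̃₂X + q̃₃` with `q̃₂ = Σ₁⁴ ãᵢrⁱ`, `q̃₃ = Σ₂⁶ b̃ᵢrⁱ` as displayed, and its discriminant is `729·Disc_x Q` (in `A[r]`, any commutative ring). [folklore computation; `ring`] -/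
theorem discr_normalise (β β₁ β₂ a₁ a₂ a₃ a₄ b₂ b₃ b₄ b₅ b₆ : A) :
    Cubic.discr (⟨1, C (3 * β),
        C (9 * a₁ - 6 * β * β₁) * X + C (9 * a₂ - 6 * β * β₂ - 3 * β₁ ^ 2) * X ^ 2 + C (9 * a₃ - 6 * β₁ * β₂) * X ^ 3 + C (9 * a₄ - 3 * β₂ ^ 2) * X ^ 4,
        C (27 * b₂ - 9 * a₁ * β₁ + 3 * β * β₁ ^ 2) * X ^ 2 + C (27 * b₃ - 9 * (a₁ * β₂ + a₂ * β₁) + 6 * β * β₁ * β₂ + 2 * β₁ ^ 3) * X ^ 3 +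
          C (27 * b₄ - 9 * (a₂ * β₂ + a₃ * β₁) + 3 * β * β₂ ^ 2 + 6 * β₁ ^ 2 * β₂) * X ^ 4 + C (27 * b₅ - 9 * (a₃ * β₂ + a₄ * β₁) + 6 * β₁ * β₂ ^ 2) * X ^ 5 +
          C (27 * b₆ - 9 * a₄ * β₂ + 2 * β₂ ^ 3) * X ^ 6⟩ : Cubic A[X]) =
      729 * Cubic.discr (⟨1, C β + C β₁ * X + C β₂ * X ^ 2, C a₁ * X + C a₂ * X ^ 2 + C a₃ * X ^ 3 + C a₄ * X ^ 4,
        C b₂ * X ^ 2 + C b₃ * X ^ 3 + C b₄ * X ^ 4 + C b₅ * X ^ 5 + C b₆ * X ^ 6⟩ : Cubic A[X]) := by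
  simp only [Cubic.discr, map_add, map_sub, map_mul, map_pow, map_ofNat]
  ring

end Ring

/-! ## §2 K-T1 for the un-normalised slice cubic -/

section Field

variable {K : Type*} [Field K]

open Polynomial in
/-- ★★★ **K-T1, GENERAL `q₁`**: over a field `K` with `2 ≠ 0`, `3 ≠ 0`, for `Q = x³ + q₁x² + q₂x + q₃ ∈ K[r][x]` with `q₁ = β + β₁r + β₂r²`, `β ≠ 0`, `q₂ = a₁r + ⋯ + a₄r⁴`,
`q₃ = b₂r² + ⋯ + b₆r⁶` (the weighted-degree-6 slice cubic at a CASE-B drop point BEFORE the Tschirnhaus shift): if the coefficients of `r⁰, …, r⁹` of `Disc_x Q` vanish, then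
`Disc_x Q = 0` — `ord_r Disc ∈ {10, 11, 12}` is impossible. (`discr_normalise` + ✓ `discr_eq_zero_of_coeff_eq_zero` for `27·Q((X − s)/3)` + `729 = 3⁶ ≠ 0`.)
[OURS · K-T1 general form; folklore computation] -/
theorem discr_eq_zero_of_coeff_eq_zero_general (h2 : (2 : K) ≠ 0) (h3 : (3 : K) ≠ 0) {β : K} (hβ : β ≠ 0)
    (β₁ β₂ a₁ a₂ a₃ a₄ b₂ b₃ b₄ b₅ b₆ : K)
    (H : ∀ i ≤ 9, (Cubic.discr (⟨1, C β + C β₁ * X + C β₂ * X ^ 2, C a₁ * X + C a₂ * X ^ 2 + C a₃ * X ^ 3 + C a₄ * X ^ 4,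
        C b₂ * X ^ 2 + C b₃ * X ^ 3 + C b₄ * X ^ 4 + C b₅ * X ^ 5 + C b₆ * X ^ 6⟩ : Cubic K[X])).coeff i = 0) :
    Cubic.discr (⟨1, C β + C β₁ * X + C β₂ * X ^ 2, C a₁ * X + C a₂ * X ^ 2 + C a₃ * X ^ 3 + C a₄ * X ^ 4,
        C b₂ * X ^ 2 + C b₃ * X ^ 3 + C b₄ * X ^ 4 + C b₅ * X ^ 5 + C b₆ * X ^ 6⟩ : Cubic K[X]) = 0 := by
  have e := discr_normalise β β₁ β₂ a₁ a₂ a₃ a₄ b₂ b₃ b₄ b₅ b₆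
  have h729 : (729 : K) ≠ 0 := by
    rw [show (729 : K) = 3 ^ 6 by norm_num]
    exact pow_ne_zero 6 h3
  have H' : ∀ i ≤ 9, (Cubic.discr (⟨1, C (3 * β),
      C (9 * a₁ - 6 * β * β₁) * X + C (9 * a₂ - 6 * β * β₂ - 3 * β₁ ^ 2) * X ^ 2 + C (9 * a₃ - 6 * β₁ * β₂) * X ^ 3 + C (9 * a₄ - 3 * β₂ ^ 2) * X ^ 4,
      C (27 * b₂ - 9 * a₁ * β₁ + 3 * β * β₁ ^ 2) * X ^ 2 + C (27 * b₃ - 9 * (a₁ * β₂ + a₂ * β₁) + 6 * β * β₁ * β₂ + 2 * β₁ ^ 3) * X ^ 3 +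
        C (27 * b₄ - 9 * (a₂ * β₂ + a₃ * β₁) + 3 * β * β₂ ^ 2 + 6 * β₁ ^ 2 * β₂) * X ^ 4 + C (27 * b₅ - 9 * (a₃ * β₂ + a₄ * β₁) + 6 * β₁ * β₂ ^ 2) * X ^ 5 +
        C (27 * b₆ - 9 * a₄ * β₂ + 2 * β₂ ^ 3) * X ^ 6⟩ : Cubic K[X])).coeff i = 0 := by
    intro i hi
    rw [e, show (729 : K[X]) = C 729 from by rw [map_ofNat], coeff_C_mul, H i hi, mul_zero]
  have hz := discr_eq_zero_of_coeff_eq_zero h2 h3 (β := 3 * β) (mul_ne_zero h3 hβ) _ _ _ _ _ _ _ _ _ H'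
  rw [e] at hz
  rcases mul_eq_zero.mp hz with h | h
  · exact absurd (by rw [show (729 : K[X]) = C 729 from by rw [map_ofNat]] at h; exact C_eq_zero.mp h) h729
  · exact h

end Field

/-! ## §3 Sharpness: `ord_r Disc = 9` is attained (the `A₈` family of res-L1-w45a-tri-2 g23 (ii′)) -/

section Sharp

variable {A : Type*} [CommRing A]

open Polynomial in
/-- **THE BOUND `9` IS ATTAINED**: for the normal-form cubic `Q = x³ + βx² + 2βc·r³·x + βc²·r⁶` (res-L1-w45a-tri-2ʼs `A₈` family `x³ + βx² + a₃r³x + a₃²r⁶/(4β)` with `a₃ = 2βc`,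
division-free), `Disc_x Q = 4β³c³·r⁹ − 27β²c⁴·r¹²` exactly — so `ord_r Disc = 9` whenever `4β³c³ ≠ 0`: together with ✓ `discr_eq_zero_of_coeff_eq_zero` («`ord ≥ 10 ⇒ Disc = 0`»)
the finite orders of the slice discriminant are exactly `≤ 9`. [folklore computation; `ring`] -/
theorem discr_A8_family (β c : A) :
    Cubic.discr (⟨1, C β, C (2 * β * c) * X ^ 3, C (β * c ^ 2) * X ^ 6⟩ : Cubic A[X]) = C (4 * β ^ 3 * c ^ 3) * X ^ 9 - C (27 * β ^ 2 * c ^ 4) * X ^ 12 := by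
  simp only [Cubic.discr, map_mul, map_pow, map_ofNat]
  ring

open Polynomial in
/-- The `r⁹`-coefficient of that discriminant is `4β³c³` and the coefficients below vanish: `ord_r Disc = 9` exactly when `4β³c³ ≠ 0` (e.g. `K` a field, `char K ≠ 2`, `β, c ≠ 0`).
[folklore computation] -/
theorem discr_A8_family_coeff (β c : A) :
    (Cubic.discr (⟨1, C β, C (2 * β * c) * X ^ 3, C (β * c ^ 2) * X ^ 6⟩ : Cubic A[X])).coeff 9 = 4 * β ^ 3 * c ^ 3 ∧
      ∀ i < 9, (Cubic.discr (⟨1, C β, C (2 * β * c) * X ^ 3, C (β * c ^ 2) * X ^ 6⟩ : Cubic A[X])).coeff i = 0 := by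
  rw [discr_A8_family]
  refine ⟨by simp only [coeff_sub, coeff_C_mul_X_pow]; simp, fun i hi => ?_⟩
  have h9 : i ≠ 9 := by omega
  have h12 : i ≠ 12 := by omega
  simp only [coeff_sub, coeff_C_mul_X_pow, if_neg h9, if_neg h12, sub_zero]

end Sharp

/-! ## §4 The bound is a `κ = 2` phenomenon: at slice ratio `κ = 3` (`deg q_j ≤ 3j`) the order `11` IS attained — res-L1-w45a-stub-2 g14ʼs class-(D) slice cubic
(`T-classD-stub2.md`, res-L1-w45a-plan-1 R25.15 (b): `Q = x³ + (1 − 2y − y² − 2y³)x² + (−y⁴ + y⁵ + y⁶)x + ¼y⁸`, `Disc_x Q = 4y¹¹ − (31/2)y¹² + …`), here in the division-free form `8·Q(x/2)` -/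

section KappaThree

variable {A : Type*} [CommRing A]

open Polynomial in
/-- ★ **ORDER `11` IS ATTAINED AT `κ = 3`** (the (D)-door at the slice level, kernel form of res-L1-w45a-stub-2ʼs cascade solution; `8·Q(x/2)` of the printed `Q`, so all coefficients are
integers and `Disc` is multiplied by `2⁶ = 64`): `Disc_x(x³ + (2 − 4y − 2y² − 4y³)x² + (−4y⁴ + 4y⁵ + 4y⁶)x + 2y⁸) = 256y¹¹ − 992y¹² + 352y¹³ + 128y¹⁴ + 3296y¹⁵ + 628y¹⁶ − 64y¹⁷` over ANY
commutative ring (`ring`). Degree shape `deg q_j ≤ 3j` (`3, 6, 8`), `q₂(0) = 0`, `ord q₃ ≥ 2` — so no analogue of `discr_eq_zero_of_coeff_eq_zero` holds on `P(1,1,3)`. [folklore computation; `ring`] -/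
theorem discr_classD_slice :
    Cubic.discr (⟨1, 2 - 4 * X - 2 * X ^ 2 - 4 * X ^ 3, -(4 * X ^ 4) + 4 * X ^ 5 + 4 * X ^ 6, 2 * X ^ 8⟩ : Cubic A[X]) =
      C 256 * X ^ 11 - C 992 * X ^ 12 + C 352 * X ^ 13 + C 128 * X ^ 14 + C 3296 * X ^ 15 + C 628 * X ^ 16 - C 64 * X ^ 17 := by
  simp only [Cubic.discr, map_ofNat]
  ring

open Polynomial in
/-- Hence `ord_y Disc = 11` exactly: the coefficients of `y⁰ … y¹⁰` vanish and the `y¹¹`-coefficient is `256 = 2⁸` (a unit in every characteristic `≠ 2`; `≡ 3 (mod 11)`, `≡ 9 (mod 13)`) —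
a WILD slice datum `in(Disc) = c·y¹¹` at `p = 11` inside the degree shape of class (D). [folklore computation] -/
theorem discr_classD_slice_coeff :
    (Cubic.discr (⟨1, 2 - 4 * X - 2 * X ^ 2 - 4 * X ^ 3, -(4 * X ^ 4) + 4 * X ^ 5 + 4 * X ^ 6, 2 * X ^ 8⟩ : Cubic A[X])).coeff 11 = 256 ∧
      ∀ i ≤ 10, (Cubic.discr (⟨1, 2 - 4 * X - 2 * X ^ 2 - 4 * X ^ 3, -(4 * X ^ 4) + 4 * X ^ 5 + 4 * X ^ 6, 2 * X ^ 8⟩ : Cubic A[X])).coeff i = 0 := by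
  rw [discr_classD_slice]
  refine ⟨?_, fun i hi => ?_⟩
  · simp only [coeff_add, coeff_sub, coeff_C_mul_X_pow]
    norm_num
  · simp only [coeff_add, coeff_sub, coeff_C_mul_X_pow]
    interval_cases i <;> norm_num

end KappaThree

end Summit.ResolutionOfSingularities.ResolutionOfSingularities.Theorems.FInjectiveMacaulayfication.SliceGenusDiscOrder
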